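import Literature.ComputerArithmetic.FloatingPoint.Formats
import Summits.Ventures.CertifiedArithmetic.LowPrec.Round

/-!
# Exact products: when `fl(x · y) = x · y` across formats

HONEST FRAMING (venture CertifiedArithmetic / cell `pub-lowprec`): certified error envelopes and
provably optimal rounding/accumulation schemes for low-precision formats under stated cost models;
every table by two implementations; no hardware or vendor claims.

The product of a finite value of `φ₁` and a finite value of `φ₂` is (the value of) a finite datum
of `ψ` as soon as `ψ` has precision `p_ψ ≥ p₁ + p₂`, a quantum dividing `quantum₁ · quantum₂`, and
enough range (`MiniFloat.exists_toRat_eq_mul`) — the classical "a `p₁`-bit by `p₂`-bit significand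
product has `p₁ + p₂` bits" [MullerEtAl2018, §4.4 / Higham2002ASNA, §2.1]. Instances: OCP FP8
products (`E4M3`, `E5M2`, mixed) are exact in `bfloat16` and `binary32`; FP4 `E2M1` products are
exact in `E4M3`; FP6 products are exact in `binary16`. Recorded NON-instances with witnesses:
`E4M3 · E4M3` overflows `binary16` (`448² = 200704 > 65504`) and `E5M2 · E5M2` underflows it
(`2^-16 · 2^-16 = 2^-32` is nonzero and below binary16's least subnormal `2^-24`).
-/

namespace Literature.ComputerArithmetic.FloatingPoint

namespace MiniFloat

variable {φ₁ φ₂ ψ : Format}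

/-- Signed magnitudes multiply: `toInt x · toInt y = ± (|x| · |y|)` with the XOR sign. [folklore] -/
theorem toInt_mul_toInt (x : MiniFloat φ₁) (y : MiniFloat φ₂) :
    x.toInt * y.toInt =
      if (x.neg != y.neg) then -((x.scaledMag * y.scaledMag : ℕ) : ℤ)
      else ((x.scaledMag * y.scaledMag : ℕ) : ℤ) := by
  unfold toInt
  cases x.neg <;> cases y.neg <;> simp

/-- Values multiply: `x · y = (toInt x · toInt y) · 2^(qexp₁ + qexp₂)`. [folklore] -/
theorem toRat_mul_toRat (x : MiniFloat φ₁) (y : MiniFloat φ₂) :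
    x.toRat * y.toRat = ((x.toInt * y.toInt : ℤ) : ℚ) * (2 : ℚ) ^ (φ₁.qexp + φ₂.qexp) := by
  unfold toRat Format.quantum
  rw [zpow_add₀ (by norm_num : (2 : ℚ) ≠ 0)]
  push_cast; ring

/-- EXACT PRODUCTS ACROSS FORMATS: if `p_ψ ≥ p₁ + p₂` (`manBits` form: `m₁ + m₂ + 1 ≤ m_ψ`),
`quantum₁ · quantum₂ = 2^d · quantum_ψ`, and `max₁ · max₂ · 2^d ≤ max_ψ` (in quanta), then every
product of finite values of `φ₁` and `φ₂` is the value of a finite datum of `ψ`.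
[cite: MullerEtAl2018, §4.4] -/
theorem exists_toRat_eq_mul (hm : φ₁.manBits + φ₂.manBits + 1 ≤ ψ.manBits) {d : ℕ}
    (hq : φ₁.qexp + φ₂.qexp = ψ.qexp + d)
    (hr : φ₁.maxScaled * φ₂.maxScaled * 2 ^ d ≤ ψ.maxScaled)
    (x : MiniFloat φ₁) (y : MiniFloat φ₂) : ∃ z : MiniFloat ψ, z.toRat = x.toRat * y.toRat := by
  -- the candidate magnitude
  have hle : x.scaledMag * y.scaledMag * 2 ^ d ≤ ψ.maxScaled :=
    le_trans (Nat.mul_le_mul_right _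
      (Nat.mul_le_mul x.scaledMag_le_maxScaled y.scaledMag_le_maxScaled)) hr
  have hrep : ψ.Representable (x.scaledMag * y.scaledMag * 2 ^ d) := by
    obtain ⟨-, k₁, j₁, hk₁, h₁⟩ := representable_iff.mp x.representable_scaledMag
    obtain ⟨-, k₂, j₂, hk₂, h₂⟩ := representable_iff.mp y.representable_scaledMag
    refine representable_iff.mpr ⟨hle, k₁ * k₂, j₁ + j₂ + d, ?_, ?_⟩
    · calc k₁ * k₂ ≤ k₁ * 2 ^ (φ₂.manBits + 1) := Nat.mul_le_mul_left _ hk₂.le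
        _ < 2 ^ (φ₁.manBits + 1) * 2 ^ (φ₂.manBits + 1) :=
            Nat.mul_lt_mul_of_pos_right hk₁ (by positivity)
        _ = 2 ^ (φ₁.manBits + φ₂.manBits + 2) := by rw [← pow_add]; congr 1; omega
        _ ≤ 2 ^ (ψ.manBits + 1) := Nat.pow_le_pow_right (by norm_num) (by omega)
    · rw [h₁, h₂]; ring
  refine ⟨ofScaled ψ (x.neg != y.neg) _ hle, ?_⟩
  rw [toRat_ofScaled hle hrep, toRat_mul_toRat, toInt_mul_toInt, hq, Format.quantum,
    zpow_add₀ (by norm_num : (2 : ℚ) ≠ 0), zpow_natCast]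
  split <;> push_cast <;> ring

/-- A nonzero finite value has magnitude at least one quantum. [folklore] -/
theorem quantum_le_abs_toRat {φ : Format} (x : MiniFloat φ) (hx : x.toRat ≠ 0) :
    φ.quantum ≤ |x.toRat| := by
  rw [abs_toRat]
  have : x.scaledMag ≠ 0 := by
    intro h0
    apply hx
    unfold toRat toInt; rw [h0]; simp
  have h1 : (1 : ℚ) ≤ x.scaledMag := by exact_mod_cast Nat.one_le_iff_ne_zero.mpr this
  nlinarith [φ.quantum_pos]

end MiniFloat

/-! ### Instances for the named formats -/

namespace Format

open MiniFloat

/-- FP4 × FP4 is exact in OCP `E4M3`: every `E2M1 · E2M1` product is an `E4M3` value.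
[cite: MullerEtAl2018, §4.4] -/
theorem E2M1_mul_E2M1_exact_in_E4M3 (x y : MiniFloat E2M1) :
    ∃ z : MiniFloat E4M3, z.toRat = x.toRat * y.toRat :=
  exists_toRat_eq_mul (by decide) (d := 7) (by decide) (by decide +kernel) x y

/-- `E4M3 · E4M3` is exact in `bfloat16`. [cite: MullerEtAl2018, §4.4] -/
theorem E4M3_mul_E4M3_exact_in_BFloat16 (x y : MiniFloat E4M3) :
    ∃ z : MiniFloat BFloat16, z.toRat = x.toRat * y.toRat :=
  exists_toRat_eq_mul (by decide) (d := 115) (by decide) (by decide +kernel) x y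

/-- `E4M3 · E4M3` is exact in `binary32`. [cite: MullerEtAl2018, §4.4] -/
theorem E4M3_mul_E4M3_exact_in_Binary32 (x y : MiniFloat E4M3) :
    ∃ z : MiniFloat Binary32, z.toRat = x.toRat * y.toRat :=
  exists_toRat_eq_mul (by decide) (d := 131) (by decide) (by decide +kernel) x y

/-- `E5M2 · E5M2` is exact in `bfloat16`. [cite: MullerEtAl2018, §4.4] -/
theorem E5M2_mul_E5M2_exact_in_BFloat16 (x y : MiniFloat E5M2) :
    ∃ z : MiniFloat BFloat16, z.toRat = x.toRat * y.toRat :=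
  exists_toRat_eq_mul (by decide) (d := 101) (by decide) (by decide +kernel) x y

/-- `E5M2 · E5M2` is exact in `binary32`. [cite: MullerEtAl2018, §4.4] -/
theorem E5M2_mul_E5M2_exact_in_Binary32 (x y : MiniFloat E5M2) :
    ∃ z : MiniFloat Binary32, z.toRat = x.toRat * y.toRat :=
  exists_toRat_eq_mul (by decide) (d := 117) (by decide) (by decide +kernel) x y

/-- Mixed `E4M3 · E5M2` is exact in `bfloat16`. [cite: MullerEtAl2018, §4.4] -/
theorem E4M3_mul_E5M2_exact_in_BFloat16 (x : MiniFloat E4M3) (y : MiniFloat E5M2) :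
    ∃ z : MiniFloat BFloat16, z.toRat = x.toRat * y.toRat :=
  exists_toRat_eq_mul (by decide) (d := 108) (by decide) (by decide +kernel) x y

/-- Mixed `E4M3 · E5M2` is exact in `binary32`. [cite: MullerEtAl2018, §4.4] -/
theorem E4M3_mul_E5M2_exact_in_Binary32 (x : MiniFloat E4M3) (y : MiniFloat E5M2) :
    ∃ z : MiniFloat Binary32, z.toRat = x.toRat * y.toRat :=
  exists_toRat_eq_mul (by decide) (d := 124) (by decide) (by decide +kernel) x y

/-- FP6 `E3M2 · E3M2` is exact in `binary16`. [cite: MullerEtAl2018, §4.4] -/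
theorem E3M2_mul_E3M2_exact_in_Binary16 (x y : MiniFloat E3M2) :
    ∃ z : MiniFloat Binary16, z.toRat = x.toRat * y.toRat :=
  exists_toRat_eq_mul (by decide) (d := 16) (by decide) (by decide +kernel) x y

/-- FP6 `E2M3 · E2M3` is exact in `binary16`. [cite: MullerEtAl2018, §4.4] -/
theorem E2M3_mul_E2M3_exact_in_Binary16 (x y : MiniFloat E2M3) :
    ∃ z : MiniFloat Binary16, z.toRat = x.toRat * y.toRat :=
  exists_toRat_eq_mul (by decide) (d := 18) (by decide) (by decide +kernel) x y

/-- Mixed FP6 `E2M3 · E3M2` is exact in `binary16`. [cite: MullerEtAl2018, §4.4] -/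
theorem E2M3_mul_E3M2_exact_in_Binary16 (x : MiniFloat E2M3) (y : MiniFloat E3M2) :
    ∃ z : MiniFloat Binary16, z.toRat = x.toRat * y.toRat :=
  exists_toRat_eq_mul (by decide) (d := 17) (by decide) (by decide +kernel) x y

/-- NON-INSTANCE (overflow witness): `E4M3 · E4M3` is NOT always a `binary16` value —
`448 · 448 = 200704` exceeds binary16's largest finite value `65504`. [folklore] -/
theorem E4M3_mul_E4M3_not_exact_in_Binary16 :
    ¬ ∀ x y : MiniFloat E4M3, ∃ z : MiniFloat Binary16, z.toRat = x.toRat * y.toRat := by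
  intro h
  obtain ⟨z, hz⟩ := h (top E4M3) (top E4M3)
  have h1 := abs_toRat_le_maxRat z
  rw [hz, Binary16_maxRat.1] at h1
  have h2 : (top E4M3).toRat = 448 := by decide +kernel
  rw [h2] at h1
  norm_num at h1

/-- NON-INSTANCE (underflow witness): `E5M2 · E5M2` is NOT always a `binary16` value —
`2^-16 · 2^-16 = 2^-32` is nonzero but below binary16's least positive subnormal `2^-24`.
[folklore] -/
theorem E5M2_mul_E5M2_not_exact_in_Binary16 :
    ¬ ∀ x y : MiniFloat E5M2, ∃ z : MiniFloat Binary16, z.toRat = x.toRat * y.toRat := by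
  intro h
  let tiny : MiniFloat E5M2 := ⟨false, 0, 1, by decide, by decide, by decide⟩
  obtain ⟨z, hz⟩ := h tiny tiny
  have ht : tiny.toRat = 1 / 2 ^ 16 := by decide +kernel
  rw [ht] at hz
  have hne : z.toRat ≠ 0 := by rw [hz]; norm_num
  have h1 := quantum_le_abs_toRat z hne
  rw [hz, Binary16_maxRat.2] at h1
  norm_num at h1

end Format

end Literature.ComputerArithmetic.FloatingPoint
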